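import Literature.NumberTheory.Automorphic.RankinSelbergLocal
import Literature.NumberTheory.Automorphic.IrreducibleClasses
import Literature.NumberTheory.Automorphic.ParabolicInductionAdmissibleProofs
import Literature.RepresentationTheory.FiniteGroups.EquivOfCharacter
import HarnessLib

/-!
# Local Rankin–Selberg predicates are invariants of the isomorphism class

`Literature/NumberTheory/Automorphic/RankinSelbergLocal.lean` phrases the local theory of
Jacquet–Piatetski-Shapiro–Shalika (Amer. J. Math. 105 (1983), §2, Thm. 2.7) through the predicates
`HasRSLFactor`, `HasRSGamma` on a pair of representations `(π, V)`, `(π', V')` of `GL_n(F)`,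
`GL_m(F)`, and all of them only see `π` through its Whittaker functions
`W_v = (g ↦ Λ(π(g) v))`, `Λ ∈ Hom_{U_n}(π, ψ_U)` (`whittakerFunctionals`, `whittakerModel` of
`WhittakerModels`). Along an isomorphism of representations `e : π ≃ σ` (Mathlib
`Representation.Equiv`) Whittaker functionals correspond by `Λ ↦ Λ ∘ e⁻¹` and
`W_{Λ, v} = W_{Λ ∘ e⁻¹, e v}`, so the SET of Whittaker functions — hence every zeta integral and
every predicate — is the same for `π` and `σ` (Cogdell, *Lectures on `L`-functions, converse
theorems, and functoriality for `GL_n`*, §1.2: the Whittaker model `𝒲(π, ψ)` depends only on the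
class of `π`; Bushnell–Henniart 2006, §36.1). The pointwise intertwining identity
`e (π(g) v) = σ(g) (e v)` used throughout is `Representation.Equiv.apply_apply` of
`Literature/RepresentationTheory/FiniteGroups/EquivOfCharacter.lean` (full name
`Literature.RepresentationTheory.FiniteGroups.Representation.Equiv.apply_apply`; for `e⁻¹` apply it
to `e.symm`). This file proves these transports, all sorry-free and without new definitions or
named facts (D-0026):

* `comp_mem_whittakerFunctionals_of_equiv`, `mem_whittakerFunctionals_iff_of_equiv`,
  `whittakerModel_comp_equiv`, `exists_whittakerModel_eq_of_equiv`,
  `isGeneric_iff_of_equiv` — Whittaker data along `e : π ≃ σ`;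
* `hasRSLFactor_iff_of_equiv_left/right`, `hasRSGamma_iff_of_equiv_left/right` — the
  `L`- and `γ`-predicates of `RankinSelbergLocal` are invariant under isomorphism in either
  variable (for every measure; the central character of `π'` transports by
  `Representation.HasCentralCharacter.of_equiv` of `IrreducibleClasses`);
* `heckeT_equiv_apply`, `isSatakeParameter_iff_of_equiv` — Hecke operators `T_i` and Satake
  parameters (`SatakeParametersGL`) along `e` (the `K₀`-fixed vectors correspond by
  `Representation.Equiv.fixedPoints_eq_map` of `ParabolicInductionAdmissibleProofs`);
* `hasRSGamma_tate_compatible_of_equiv` — consequently the named fact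
  `hasRSGamma_tate_compatible π ψ μ` (JPSS 1983, Thm. 3.1 with §2, `GL_1 × GL_1` = Tate; the
  case `m = 1` of the local functional equation for unramified generic `π`) holds for `π` as soon
  as it holds for some isomorphic `σ`: the reduction "without loss of generality `π` is a model"
  (e.g. the full induced representation `Ind(χ_1, …, χ_n)`, Cogdell, *Analytic theory of
  `L`-functions for `GL_n`*, §3.1, p. 195) used by every proof of that fact.

## References

* H. Jacquet, I. I. Piatetski-Shapiro, J. Shalika, *Rankin–Selberg convolutions*, Amer. J. Math.
  105 (1983), 367–464, §2, Thm. 2.7, Thm. 3.1. [JacquetPiatetskiShapiroShalika1983]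
* J. W. Cogdell, *Lectures on `L`-functions, converse theorems, and functoriality for `GL_n`*,
  Fields Inst. Monogr. 20 (2004), §1.2, §6.1. [Cogdell2004]
* C. J. Bushnell, G. Henniart, *The local Langlands conjecture for `GL(2)`*, Springer 2006, §1.1,
  §36.1. [BushnellHenniart2006]
-/

set_option autoImplicit false

open MeasureTheory Polynomial

noncomputable section

namespace Literature.NumberTheory.Automorphic

/-! ### Whittaker functionals and Whittaker functions along an isomorphism -/

section Whittaker

variable {R : Type*} [CommRing R] {n : ℕ}
  {V : Type*} [AddCommGroup V] [Module ℂ V] {W : Type*} [AddCommGroup W] [Module ℂ W]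
  {π : Representation ℂ (GL (Fin n) R) V} {σ : Representation ℂ (GL (Fin n) R) W}
  {ψ : AddChar R Circle}

/-- **Whittaker functionals pull back along an isomorphism**: if `Λ ∈ Hom_{U_n}(σ, ψ_U)` and
`e : π ≃ σ`, then `Λ ∘ e ∈ Hom_{U_n}(π, ψ_U)`. (Cogdell 2004, §1.2; Bushnell–Henniart 2006,
§36.1.) [cite: Cogdell2004, §1.2] -/
theorem comp_mem_whittakerFunctionals_of_equiv (e : π.Equiv σ) {Λ : Module.Dual ℂ W}
    (hΛ : Λ ∈ whittakerFunctionals σ ψ) :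
    Λ ∘ₗ (e.toLinearEquiv : V →ₗ[ℂ] W) ∈ whittakerFunctionals π ψ := by
  rw [mem_whittakerFunctionals_iff] at hΛ ⊢
  intro u v
  change Λ (e (π (u : GL (Fin n) R) v)) = whittakerCharFun ψ u * Λ (e v)
  rw [RepresentationTheory.FiniteGroups.Representation.Equiv.apply_apply, hΛ]

/-- `Λ` is a Whittaker functional of `π` iff `Λ ∘ e⁻¹` is one of `σ` (`e : π ≃ σ`). [folklore] -/
theorem mem_whittakerFunctionals_iff_of_equiv (e : π.Equiv σ) (Λ : Module.Dual ℂ V) :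
    Λ ∈ whittakerFunctionals π ψ ↔
      Λ ∘ₗ (e.symm.toLinearEquiv : W →ₗ[ℂ] V) ∈ whittakerFunctionals σ ψ := by
  constructor
  · intro hΛ
    exact comp_mem_whittakerFunctionals_of_equiv e.symm hΛ
  · intro hΛ
    have h := comp_mem_whittakerFunctionals_of_equiv e hΛ
    have hid : (Λ ∘ₗ (e.symm.toLinearEquiv : W →ₗ[ℂ] V)) ∘ₗ (e.toLinearEquiv : V →ₗ[ℂ] W) = Λ := by
      ext v
      change Λ (e.symm (e v)) = Λ v
      rw [Representation.Equiv.symm_apply_apply]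
    rwa [hid] at h

/-- **Whittaker functions are unchanged**: `W_{Λ ∘ e, v} = W_{Λ, e v}` for `e : π ≃ σ`, i.e.
`Λ(e(π(g) v)) = Λ(σ(g)(e v))`. (Cogdell 2004, §1.2.) [cite: Cogdell2004, §1.2] -/
theorem whittakerModel_comp_equiv (e : π.Equiv σ) (Λ : Module.Dual ℂ W) (v : V) :
    whittakerModel π (Λ ∘ₗ (e.toLinearEquiv : V →ₗ[ℂ] W)) v = whittakerModel σ Λ (e v) := by
  ext g
  rw [whittakerModel_apply, whittakerModel_apply]
  change Λ (e (π g v)) = Λ (σ g (e v))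
  rw [RepresentationTheory.FiniteGroups.Representation.Equiv.apply_apply]

/-- `W_{Λ ∘ e, e⁻¹ w} = W_{Λ, w}` for `e : π ≃ σ`. [folklore] -/
theorem whittakerModel_comp_equiv_symm_apply (e : π.Equiv σ) (Λ : Module.Dual ℂ W) (w : W) :
    whittakerModel π (Λ ∘ₗ (e.toLinearEquiv : V →ₗ[ℂ] W)) (e.symm w) = whittakerModel σ Λ w := by
  rw [whittakerModel_comp_equiv, Representation.Equiv.apply_symm_apply]

/-- Every Whittaker function `W_{Λ, v}` of `π` is a Whittaker function `W_{Λ ∘ e⁻¹, e v}` of the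
isomorphic `σ` (same `ψ`). (Cogdell 2004, §1.2.) [cite: Cogdell2004, §1.2] -/
theorem exists_whittakerModel_eq_of_equiv (e : π.Equiv σ) {Λ : Module.Dual ℂ V}
    (hΛ : Λ ∈ whittakerFunctionals π ψ) (v : V) :
    ∃ Λ' ∈ whittakerFunctionals σ ψ, ∃ w : W, whittakerModel σ Λ' w = whittakerModel π Λ v := by
  refine ⟨Λ ∘ₗ (e.symm.toLinearEquiv : W →ₗ[ℂ] V), (mem_whittakerFunctionals_iff_of_equiv e Λ).1 hΛ,
    e v, ?_⟩
  refine (whittakerModel_comp_equiv e.symm Λ (e v)).trans ?_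
  rw [Representation.Equiv.symm_apply_apply]

/-- **Genericity is an isomorphism invariant**: `π` is `ψ`-generic iff the isomorphic `σ` is.
(Cogdell 2004, §1.2; Bushnell–Henniart 2006, §36.1.) [cite: Cogdell2004, §1.2] -/
theorem isGeneric_iff_of_equiv (e : π.Equiv σ) : IsGeneric π ψ ↔ IsGeneric σ ψ := by
  rw [isGeneric_iff, isGeneric_iff]
  constructor
  · rintro ⟨Λ, hΛ, hΛ0⟩
    refine ⟨Λ ∘ₗ (e.symm.toLinearEquiv : W →ₗ[ℂ] V),
      (mem_whittakerFunctionals_iff_of_equiv e Λ).1 hΛ, fun h => hΛ0 ?_⟩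
    ext v
    have := LinearMap.congr_fun h (e v)
    change Λ (e.symm (e v)) = 0 at this
    rwa [Representation.Equiv.symm_apply_apply] at this
  · rintro ⟨Λ, hΛ, hΛ0⟩
    refine ⟨Λ ∘ₗ (e.toLinearEquiv : V →ₗ[ℂ] W), comp_mem_whittakerFunctionals_of_equiv e hΛ,
      fun h => hΛ0 ?_⟩
    ext w
    have := LinearMap.congr_fun h (e.symm w)
    change Λ (e (e.symm w)) = 0 at this
    rwa [Representation.Equiv.apply_symm_apply] at this

end Whittaker

/-! ### `HasRSLFactor` and `HasRSGamma` are isomorphism invariants -/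

section Predicates

variable {F : Type*} [Field F] [ValuativeRel F] [TopologicalSpace F]
  [IsNonarchimedeanLocalField F] {n m : ℕ}
  {V : Type*} [AddCommGroup V] [Module ℂ V] {V₁ : Type*} [AddCommGroup V₁] [Module ℂ V₁]
  {V' : Type*} [AddCommGroup V'] [Module ℂ V'] {V'₁ : Type*} [AddCommGroup V'₁] [Module ℂ V'₁]
  [MeasurableSpace (GL (Fin m) F ⧸ upperUnitriangular (Fin m) F)]
  {hmn : m < n} {π : Representation ℂ (GL (Fin n) F) V} {σ : Representation ℂ (GL (Fin n) F) V₁}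
  {π' : Representation ℂ (GL (Fin m) F) V'} {σ' : Representation ℂ (GL (Fin m) F) V'₁}
  {ψ : AddChar F Circle} {ν : Measure (GL (Fin m) F ⧸ upperUnitriangular (Fin m) F)}

/-- One direction of `hasRSLFactor_iff_of_equiv_left`. [folklore] -/
private theorem hasRSLFactor_of_equiv_left (e : π.Equiv σ) {P : ℂ[X]}
    (h : HasRSLFactor hmn σ π' ψ ν P) : HasRSLFactor hmn π π' ψ ν P := by
  obtain ⟨hP, hrat, k, Λ, Λ', v, v', Q, hΛ, hΛ', hQ, hsum⟩ := h
  refine ⟨hP, fun Λ₀ hΛ₀ Λ'₀ hΛ'₀ v₀ v'₀ => ?_, ?_⟩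
  · obtain ⟨Λ₁, hΛ₁, w, hw⟩ := exists_whittakerModel_eq_of_equiv (ψ := ψ) e hΛ₀ v₀
    obtain ⟨Rr, hRr, hR⟩ := hrat Λ₁ hΛ₁ Λ'₀ hΛ'₀ w v'₀
    exact ⟨Rr, hRr, by rwa [hw] at hR⟩
  · refine ⟨k, fun i => Λ i ∘ₗ (e.toLinearEquiv : V →ₗ[ℂ] V₁), Λ', fun i => e.symm (v i), v', Q,
      fun i => comp_mem_whittakerFunctionals_of_equiv e (hΛ i), hΛ', hQ, ?_⟩
    convert hsum using 5
    exact whittakerModel_comp_equiv_symm_apply e _ _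

/-- **`L(s, π × π')` only depends on the isomorphism class of `π`**: for `e : π ≃ σ`,
`HasRSLFactor hmn π π' ψ ν P ↔ HasRSLFactor hmn σ π' ψ ν P` (both clauses of the predicate
quantify over the Whittaker functions `W_{Λ, v}`, which are the same for `π` and `σ`).
(JPSS 1983, Thm. 2.7 (i)–(ii); Cogdell 2004, §1.2, §6.1.) [cite: Cogdell2004, §6.1] -/
theorem hasRSLFactor_iff_of_equiv_left (e : π.Equiv σ) (P : ℂ[X]) :
    HasRSLFactor hmn π π' ψ ν P ↔ HasRSLFactor hmn σ π' ψ ν P :=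
  ⟨hasRSLFactor_of_equiv_left e.symm, hasRSLFactor_of_equiv_left e⟩

/-- One direction of `hasRSLFactor_iff_of_equiv_right`. [folklore] -/
private theorem hasRSLFactor_of_equiv_right (e' : π'.Equiv σ') {P : ℂ[X]}
    (h : HasRSLFactor hmn π σ' ψ ν P) : HasRSLFactor hmn π π' ψ ν P := by
  obtain ⟨hP, hrat, k, Λ, Λ', v, v', Q, hΛ, hΛ', hQ, hsum⟩ := h
  refine ⟨hP, fun Λ₀ hΛ₀ Λ'₀ hΛ'₀ v₀ v'₀ => ?_, ?_⟩
  · obtain ⟨Λ₁, hΛ₁, w, hw⟩ := exists_whittakerModel_eq_of_equiv (ψ := ψ⁻¹) e' hΛ'₀ v'₀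
    obtain ⟨Rr, hRr, hR⟩ := hrat Λ₀ hΛ₀ Λ₁ hΛ₁ v₀ w
    exact ⟨Rr, hRr, by rwa [hw] at hR⟩
  · refine ⟨k, Λ, fun i => Λ' i ∘ₗ (e'.toLinearEquiv : V' →ₗ[ℂ] V'₁), v, fun i => e'.symm (v' i), Q,
      hΛ, fun i => comp_mem_whittakerFunctionals_of_equiv e' (hΛ' i), hQ, ?_⟩
    convert hsum using 5
    exact whittakerModel_comp_equiv_symm_apply e' _ _

/-- **`L(s, π × π')` only depends on the isomorphism class of `π'`**: for `e' : π' ≃ σ'`,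
`HasRSLFactor hmn π π' ψ ν P ↔ HasRSLFactor hmn π σ' ψ ν P`.
(JPSS 1983, Thm. 2.7 (i)–(ii); Cogdell 2004, §1.2, §6.1.) [cite: Cogdell2004, §6.1] -/
theorem hasRSLFactor_iff_of_equiv_right (e' : π'.Equiv σ') (P : ℂ[X]) :
    HasRSLFactor hmn π π' ψ ν P ↔ HasRSLFactor hmn π σ' ψ ν P :=
  ⟨hasRSLFactor_of_equiv_right e'.symm, hasRSLFactor_of_equiv_right e'⟩

variable [MeasurableSpace F] {μ : Measure F}

/-- One direction of `hasRSGamma_iff_of_equiv_left`. [folklore] -/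
private theorem hasRSGamma_of_equiv_left (e : π.Equiv σ) {γ : RatFunc ℂ}
    (h : HasRSGamma hmn σ π' ψ μ ν γ) : HasRSGamma hmn π π' ψ μ ν γ := by
  obtain ⟨ω, hω, hFE⟩ := h
  refine ⟨ω, hω, fun Λ₀ hΛ₀ Λ'₀ hΛ'₀ v₀ v'₀ => ?_⟩
  obtain ⟨Λ₁, hΛ₁, w, hw⟩ := exists_whittakerModel_eq_of_equiv (ψ := ψ) e hΛ₀ v₀
  obtain ⟨Rr, Rt, hR, hRt, hγ⟩ := hFE Λ₁ hΛ₁ Λ'₀ hΛ'₀ w v'₀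
  exact ⟨Rr, Rt, by rwa [hw] at hR, by rwa [hw] at hRt, hγ⟩

/-- **`γ(s, π × π', ψ)` only depends on the isomorphism class of `π`**: for `e : π ≃ σ` and
every `γ`, `HasRSGamma hmn π π' ψ μ ν γ ↔ HasRSGamma hmn σ π' ψ μ ν γ` (both sides of the local
functional equation are zeta integrals of Whittaker functions `W_{Λ, v}`, `ρ(w_{n,m}) W̃_{Λ, v}`,
the same for `π` and `σ`). (JPSS 1983, Thm. 2.7 (iii); Cogdell 2004, §1.2, §6.1.) [cite: Cogdell2004, §6.1] -/
theorem hasRSGamma_iff_of_equiv_left (e : π.Equiv σ) (γ : RatFunc ℂ) :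
    HasRSGamma hmn π π' ψ μ ν γ ↔ HasRSGamma hmn σ π' ψ μ ν γ :=
  ⟨hasRSGamma_of_equiv_left e.symm, hasRSGamma_of_equiv_left e⟩

/-- One direction of `hasRSGamma_iff_of_equiv_right`. [folklore] -/
private theorem hasRSGamma_of_equiv_right (e' : π'.Equiv σ') {γ : RatFunc ℂ}
    (h : HasRSGamma hmn π σ' ψ μ ν γ) : HasRSGamma hmn π π' ψ μ ν γ := by
  obtain ⟨ω, hω, hFE⟩ := h
  refine ⟨ω, hω.of_equiv e'.symm, fun Λ₀ hΛ₀ Λ'₀ hΛ'₀ v₀ v'₀ => ?_⟩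
  obtain ⟨Λ₁, hΛ₁, w, hw⟩ := exists_whittakerModel_eq_of_equiv (ψ := ψ⁻¹) e' hΛ'₀ v'₀
  obtain ⟨Rr, Rt, hR, hRt, hγ⟩ := hFE Λ₀ hΛ₀ Λ₁ hΛ₁ v₀ w
  exact ⟨Rr, Rt, by rwa [hw] at hR, by rwa [hw] at hRt, hγ⟩

/-- **`γ(s, π × π', ψ)` only depends on the isomorphism class of `π'`**: for `e' : π' ≃ σ'`,
`HasRSGamma hmn π π' ψ μ ν γ ↔ HasRSGamma hmn π σ' ψ μ ν γ`; the central character `ω_{π'}`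
entering the sign `ω_{π'}(-1)^{n-1}` transports by `Representation.HasCentralCharacter.of_equiv`.
(JPSS 1983, Thm. 2.7 (iii); Cogdell 2004, §1.2, §6.1.) [cite: Cogdell2004, §6.1] -/
theorem hasRSGamma_iff_of_equiv_right (e' : π'.Equiv σ') (γ : RatFunc ℂ) :
    HasRSGamma hmn π π' ψ μ ν γ ↔ HasRSGamma hmn π σ' ψ μ ν γ :=
  ⟨hasRSGamma_of_equiv_right e'.symm, hasRSGamma_of_equiv_right e'⟩

end Predicates

/-! ### Hecke operators and Satake parameters along an isomorphism -/

section Satake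

variable {F : Type*} [Field F] [ValuativeRel F] [TopologicalSpace F]
  [IsNonarchimedeanLocalField F] {n : ℕ}
  {V : Type*} [AddCommGroup V] [Module ℂ V] {W : Type*} [AddCommGroup W] [Module ℂ W]
  {π : Representation ℂ (GL (Fin n) F) V} {σ : Representation ℂ (GL (Fin n) F) W}

/-- If the double coset `K g K / K` is infinite, the (junk) Hecke operator `[K g K]` vanishes
(the `finsum` of a function with infinite support is `0`; same statement as the private lemmas of
`HeckeEigenvectorProjection` / `JacquetLanglandsParts`, reproved to keep imports minimal).
[folklore] -/
private theorem heckeOperator_eq_zero_of_infinite_orbit {k G U : Type*} [CommRing k] [Group G]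
    [AddCommGroup U] [Module k U] (ρ : Representation k G U) (K : Subgroup G) (g : G)
    (hK : (MulAction.orbit K (g : G ⧸ K)).Infinite) : heckeOperator ρ K g = 0 := by
  rcases subsingleton_or_nontrivial U with hU | hU
  · exact LinearMap.ext fun v => Subsingleton.elim _ _
  rw [heckeOperator]
  apply finsum_mem_eq_zero_of_infinite
  rw [Set.inter_eq_self_of_subset_left]
  · exact hK
  · intro y _
    rw [Function.mem_support]
    intro h0
    obtain ⟨w, hw⟩ := exists_ne (0 : U)
    apply hw
    have : ρ (y.out)⁻¹ (ρ y.out w) = w := by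
      rw [← Module.End.mul_apply, ← map_mul, inv_mul_cancel, map_one, Module.End.one_apply]
    rw [← this, h0, LinearMap.zero_apply, map_zero]

omit [TopologicalSpace F] [IsNonarchimedeanLocalField F] in
/-- **An isomorphism intertwines the Hecke operators** `T_i = [K₀ diag(ϖ,…,ϖ,1,…,1) K₀]`:
`e (T_i v) = T_i (e v)` (same coset representatives `Quotient.out` on both sides, so this holds on
every vector; if the double coset is an infinite union of cosets both `finsum`s are `0`).
(Cartier, Corvallis 1979, §IV.1; folklore.) [folklore] -/
theorem heckeT_equiv_apply (e : π.Equiv σ) (ϖ : Fˣ) (i : ℕ) (v : V) :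
    e (heckeT π ϖ i v) = heckeT σ ϖ i (e v) := by
  classical
  rw [heckeT_def, heckeT_def]
  by_cases hfin : (MulAction.orbit (glInt n F) (heckeDiag n ϖ i : GL (Fin n) F ⧸ glInt n F)).Finite
  · rw [heckeOperator, heckeOperator, finsum_mem_eq_finite_toFinset_sum _ hfin,
      finsum_mem_eq_finite_toFinset_sum _ hfin, LinearMap.sum_apply, LinearMap.sum_apply, map_sum]
    exact Finset.sum_congr rfl fun y _ =>
      RepresentationTheory.FiniteGroups.Representation.Equiv.apply_apply e _ _
  · rw [heckeOperator_eq_zero_of_infinite_orbit π _ _ hfin,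
      heckeOperator_eq_zero_of_infinite_orbit σ _ _ hfin, LinearMap.zero_apply,
      LinearMap.zero_apply, map_zero]

/-- One direction of `isSatakeParameter_iff_of_equiv`. [folklore] -/
private theorem isSatakeParameter_of_equiv (e : π.Equiv σ) {ϖ : Fˣ} {α : Multiset ℂ}
    (h : IsSatakeParameter π ϖ α) : IsSatakeParameter σ ϖ α := by
  obtain ⟨hcard, v, hv, hv0, hT⟩ := h
  refine ⟨hcard, e v, ?_, fun h0 => hv0 ?_, fun i hi => ?_⟩
  · rw [e.fixedPoints_eq_map]
    exact Submodule.mem_map_of_mem hv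
  · have := congrArg e.symm h0
    rwa [Representation.Equiv.symm_apply_apply, map_zero] at this
  · rw [← heckeT_equiv_apply, hT i hi, map_smul]

/-- **Satake parameters are isomorphism invariants**: `α` is a Satake parameter of `π` iff it is
one of the isomorphic `σ` (`e` maps the non-zero `K₀`-fixed common `T_i`-eigenvector of `π` to one
of `σ` with the same eigenvalues, `Representation.Equiv.fixedPoints_eq_map`, `heckeT_equiv_apply`).
(Cartier, Corvallis 1979, §IV.4; Borel, Corvallis 1979, §7.) [cite: CartierCorvallis1979, §IV.4] -/
theorem isSatakeParameter_iff_of_equiv (e : π.Equiv σ) (ϖ : Fˣ) (α : Multiset ℂ) :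
    IsSatakeParameter π ϖ α ↔ IsSatakeParameter σ ϖ α :=
  ⟨isSatakeParameter_of_equiv e, isSatakeParameter_of_equiv e.symm⟩

end Satake

/-! ### The named fact `hasRSGamma_tate_compatible` along an isomorphism -/

section TateCompatible

variable {F : Type*} [Field F] [ValuativeRel F] [TopologicalSpace F]
  [IsNonarchimedeanLocalField F] {n : ℕ}
  {V : Type*} [AddCommGroup V] [Module ℂ V] {W : Type*} [AddCommGroup W] [Module ℂ W]
  {π : Representation ℂ (GL (Fin n) F) V} {σ : Representation ℂ (GL (Fin n) F) W}
  {ψ : AddChar F Circle} [MeasurableSpace F] {μ : Measure F}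

/-- **`hasRSGamma_tate_compatible` is an isomorphism invariant.** The named fact
`hasRSGamma_tate_compatible π ψ μ` of `RankinSelbergLocal` (Jacquet–Piatetski-Shapiro–Shalika 1983,
Thm. 3.1 and §2, `GL_1 × GL_1` = Tate: for `π` irreducible admissible generic unramified with
Satake parameters `χ_i(ϖ)`, `γ(s, π × χ, ψ) = ∏ᵢ γ(s, χ_i χ, ψ)`) holds for `π` as soon as it
holds for a representation `σ` isomorphic to `π`: irreducibility, admissibility, genericity and
the Satake parameters pass from `π` to `σ` (`Representation.Equiv.isIrreducible`,
`Representation.IsAdmissible.of_equiv`, `isGeneric_iff_of_equiv`,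
`isSatakeParameter_iff_of_equiv`) and the conclusion `HasRSGamma` passes back
(`hasRSGamma_iff_of_equiv_left`). This is the step "without loss of generality `π` is the full
induced representation `Ind(χ_1, …, χ_n)`" (Cogdell, *Analytic theory of `L`-functions for
`GL_n`*, §3.1, p. 195) of any proof of the fact; it introduces no hypothesis on `π`.
[cite: JacquetPiatetskiShapiroShalika1983, Thm. 3.1 and §2] -/
theorem hasRSGamma_tate_compatible_of_equiv (e : π.Equiv σ)
    (h : hasRSGamma_tate_compatible σ ψ μ) : hasRSGamma_tate_compatible π ψ μ := by
  intro hn _ hπ hg hψ hμ μ' _ _ _ ν₁ _ _ _ ϖ hϖ χs hunr hα χ γ hγ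
  haveI : σ.IsIrreducible := e.isIrreducible
  have hσ : σ.IsAdmissible := hπ.of_equiv e
  have hgσ : IsGeneric σ ψ := (isGeneric_iff_of_equiv e).1 hg
  have hασ := (isSatakeParameter_iff_of_equiv e ϖ _).1 hα
  exact (hasRSGamma_iff_of_equiv_left e _).2
    (h hn hσ hgσ hψ hμ μ' ν₁ hϖ χs hunr hασ χ γ hγ)

end TateCompatible

end Literature.NumberTheory.Automorphic
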